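import Summits.NavierStokesRegularity.NavierStokesRegularity.Theorems.PalasekTowerBreakdownEpisodeBaseTSterileGermRun
import Summits.NavierStokesRegularity.NavierStokesRegularity.Theorems.PalasekTowerBreakdownEpisodeBaseTSterileDoorOfCarrier
import Summits.NavierStokesRegularity.FluidComputer.PalasekTowerSterileMechanismDoorAt
import Summits.NavierStokesRegularity.FluidComputer.PalasekTowerSterileMechanismDoorAtScaled

/-!
# THE STERILE MECHANISM DOOR, BY NAME: every AXISYMMETRIC SWIRL-FREE amplifier meeting the door box of a register-admissible
# `R` inhabits `NoSwirlRungGAt R 1`; at `tuned` this is stub D2 `SterileMechanismDoorT` of the line «doormirror» VERBATIM, hence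
# (K201) such an amplifier gives `EpisodeBaseT ∧ ¬ (HeredityAtOneT ∧ HeredityFromTwoT)`

Cell `ns-blowup`, seat `ns-blowup-fc-prover-2` (g11; D-0074 GROUP C «BRIDGE SUPPORT»). Route `PalasekTowerBreakdown` (rev 19):
crux stmt-NavierStokesRegularity-20303 `EpisodeBaseT`, heredity pair 20304 `HeredityAtOneT` / 20305 `HeredityFromTwoT`.
LABEL: E–C typing (KERNEL: theorems only; `--supports` stmt-NavierStokesRegularity-20303 as helper). WHAT THIS IS NOT: not
Navier–Stokes evidence — no amplifier, free run, stage or design is exhibited; the route decls appear only as conclusions of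
conditionals whose hypothesis is ONE free run of a STERILE amplifier meeting the PLAIN door box (READING 2 of DIRECTOR-NS #74,
no level-`0` face, no anchor); nothing registers and no census number moves.

## The statement

The strategist's line `Cruxes/EpisodeBaseT/Lines/doormirror.lean` v3 (cstrat-19179 g3) has, besides the computation T1′
`SterileDoorBoxT`, the kernel stub D2 `SterileMechanismDoorT` («the mechanism door walked STERILE»), cut in v3 into D2a
`SterileSmallCarrierT` (an EXPLICIT axisymmetric swirl-free strict-slot carrier at `tuned` of every `L³` size — OPEN until this
file) and D2b `SterileSmallCarrierT → SterileMechanismDoorT` (plumbing; ecbridge-3 g12 p562247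
`palasekTowerBreakdown_sterileMechanismDoorT_of_sterileSmallCarrierT`, landed). This file CLOSES D2a and hence D2:
**`palasekTowerBreakdown_sterileSmallCarrierT`** has exactly the body of `DoorMirror.SterileSmallCarrierT` as its type and
**`palasekTowerBreakdown_sterileMechanismDoorT`** exactly the body of `DoorMirror.SterileMechanismDoorT` (the line file is not
imported — it carries `sorry`s —, so both stubs close there by `exact`). The explicit object is the STERILE tame carrier of
`PalasekTowerSterileCarrierAt`: the flat even blob of record plus the coaxial poloidal RING PUSHER `curl (f(s) η((x₂−5)/δ) J)`
(`PalasekTowerRingPusher`), whose strict anchor face is the sign theorem `exists_ringPusher_anchor_integral_pos`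
(`PalasekTowerRingPusherSign`: the integrand is an INDEFINITE form for poloidal fields; SOS envelope + cylindrical separation +
pancake scaling). Also by name: the `R`-generic door `palasekTowerBreakdown_noSwirlRungGAt_one_of_sterile_amplifier` (over this
seat's Theses-free `exists_sterile_levelZeroDataAt_freeRun_of_sterile_amplifier`; ecbridge-3's p563471 is the conditional twin),
the K201 consequence **`palasekTowerBreakdown_episodeBaseT_and_not_heredity_pair_of_sterile_amplifier`** (ONE free run of a sterile
amplifier meeting the PLAIN door box at `tuned` gives `EpisodeBaseT ∧ ¬ (HeredityAtOneT ∧ HeredityFromTwoT)` — destination (A) of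
the STERILE-DOOR test is a #64 (4) fork input through the door OF RECORD re-walked sterile, plan l.10380 №2, no longer modulo D2′),
its KIT-UNITS forms over `StrainDoor.SterileDoorAt.of_scaledFreeRun` (centre on the axis, free `t_a, κ, ν'`), and the UNCONDITIONAL
level-`0` facts: `NoSwirlRungGAt TowerRates.tuned 0` is INHABITED (the sterile germ schedule), hence heredity breaks at SOME
definite level `k ≥ 0` inside the swirl-free stratum (`k = 0` expected; no item is claimed refuted).

References: S. Palasek, arXiv:2605.13827 §3.3–§4 [cite: Palasek2026ElementaryModel, §4]; T. Kato, Math. Z. 187 (1984) Thm. 2–4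
[cite: Kato1984, Thm. 2–4]; P. G. Lemarié-Rieusset (2016) Thm 10.4 [cite: LemarieRieusset2016, Thm 10.4 (p. 285)]; A. J. Majda,
A. L. Bertozzi (CUP 2002) §1.8 Prop. 1.16 [cite: MajdaBertozziCUP2002, §1.8 Prop. 1.16].
-/

noncomputable section

-- `Summit.<Summit>.<Problem>` is the tree's mandated summit-side namespace (CONVENTIONS §2); for this
-- single-conjunct summit the two coincide, so the duplicate is deliberate.
set_option linter.dupNamespace false

namespace Summit.NavierStokesRegularity.NavierStokesRegularity.Theorems

open Set Function MeasureTheory Metric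
open scoped ENNReal ContDiff RealInnerProductSpace
open Summit.NavierStokesRegularity.NavierStokesRegularity.Theses
open Summit.NavierStokesRegularity.FluidComputer.PalasekTowerClayBridge
open Summit.NavierStokesRegularity.FluidComputer.PalasekTowerClayBridge.Germ
open Summit.NavierStokesRegularity.HeredityFromTwoTNoSwirl
open Literature.Analysis.FluidPDE

/-! ## Stub D2a: sterile strict-slot carriers of every `L³` size (the explicit object) -/

/-- **STERILE STRICT-SLOT CARRIERS OF EVERY `L³` SIZE AT EVERY RATES RECORD `R`**: for every `δ > 0` an axisymmetric swirl-free
profile filling `Germ.LevelZeroDataAt R · 7` with `‖·‖_{L³} ≤ δ` — the sterile tame carrier `sterileCarrierAt R a μ` (blob + coaxial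
ring pusher) at small `a`, `μ`. [cite: Palasek2026ElementaryModel, §3.3] [cite: Kato1984, Thm. 2] -/
theorem palasekTowerBreakdown_sterileSmallCarrierGAt (R : TowerRates) :
    ∀ δ : ℝ, 0 < δ →
      ∃ U : EuclideanSpace ℝ (Fin 3) → EuclideanSpace ℝ (Fin 3),
        IsAxisymmetric U ∧ HasNoSwirl U ∧ LevelZeroDataAt R U 7 ∧ (eLpNorm U 3 volume).toReal ≤ δ := fun δ hδ => by
  obtain ⟨U, hLZ, hax, hsw, -, -, -, -, hL3⟩ := exists_sterile_levelZeroDataAt_small R δ hδ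
  exact ⟨U, hax, hsw, hLZ, hL3⟩

/-- **STUB D2a `SterileSmallCarrierT` OF THE LINE «doormirror», VERBATIM** (at `tuned`). [cite: Palasek2026ElementaryModel, §3.3] -/
theorem palasekTowerBreakdown_sterileSmallCarrierT :
    ∀ δ : ℝ, 0 < δ →
      ∃ U : EuclideanSpace ℝ (Fin 3) → EuclideanSpace ℝ (Fin 3),
        IsAxisymmetric U ∧ HasNoSwirl U ∧ Germ.LevelZeroDataAt TowerRates.tuned U 7 ∧ (eLpNorm U 3 volume).toReal ≤ δ :=
  palasekTowerBreakdown_sterileSmallCarrierGAt TowerRates.tuned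

/-! ## Stub D2: the sterile mechanism door -/

/-- **THE STERILE MECHANISM DOOR AT EVERY REGISTER-ADMISSIBLE `R`**: `hR : R.BoxNumerics c₃ r`; for every AXISYMMETRIC
SWIRL-FREE smooth divergence-free `W` with `tsupport W ⊆ B̄(0, ρ)` (`ρ ≥ 0`), speed `< Y₀(R)`, and every classical finite-energy
FREE run on `[1, τfirstAt R]` from `W` under `(5/3)Y₁(R) − η` (`η > 0`) showing at `τfirstAt R`, inside `‖x‖ ≤ ρ`, the speed
`Y₁(R) + η`, the gradient `A₁(R) + η` and an `N₁(R)`-core loop of circulation `≥ N₁(R)^{β−2} + η` — the swirl-free witness class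
`NoSwirlRungGAt R 1` is inhabited. [cite: Palasek2026ElementaryModel, §4] [cite: Kato1984, Thm. 2–4] -/
theorem palasekTowerBreakdown_noSwirlRungGAt_one_of_sterile_amplifier {R : TowerRates} {c₃ r : ℝ} (hR : R.BoxNumerics c₃ r)
    {W : EuclideanSpace ℝ (Fin 3) → EuclideanSpace ℝ (Fin 3)} {ρ : ℝ} (hax : IsAxisymmetric W) (hsw : HasNoSwirl W)
    (hW : ContDiff ℝ ∞ W) (hdivW : VectorCalculus.IsDivFree W) (hWsupp : tsupport W ⊆ closedBall 0 ρ)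
    (hWlt : ∀ x, ‖W x‖ < R.Y 0) (hρ : 0 ≤ ρ)
    {v : ℝ → EuclideanSpace ℝ (Fin 3) → EuclideanSpace ℝ (Fin 3)} {q : ℝ → EuclideanSpace ℝ (Fin 3) → ℝ}
    (hv : IsClassicalNSSolutionOn (Icc 1 (Host.τfirstAt R)) 1 0 v q) (hv1 : v 1 = W)
    (hvE : ∃ C : ℝ≥0∞, C < ⊤ ∧ ∀ t ∈ Icc (1 : ℝ) (Host.τfirstAt R), ∫⁻ x, ‖v t x‖ₑ ^ 2 ≤ C)
    {η : ℝ} (hη : 0 < η)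
    (hcap : ∀ t ∈ Icc (1 : ℝ) (Host.τfirstAt R), ∀ x, ‖v t x‖ ≤ 5 / 3 * R.Y 1 - η)
    (hspeed : ∃ x, ‖x‖ ≤ ρ ∧ R.Y 1 + η ≤ ‖v (Host.τfirstAt R) x‖)
    (hstrain : ∃ x, ‖x‖ ≤ ρ ∧ R.A 1 + η ≤ ‖fderiv ℝ (v (Host.τfirstAt R)) x‖)
    (hcore : ∃ (x : EuclideanSpace ℝ (Fin 3)) (γ : ℝ → EuclideanSpace ℝ (Fin 3)),
      ‖x‖ ≤ ρ ∧ ContDiff ℝ 1 γ ∧ γ 0 = γ 1 ∧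
      (∀ s ∈ Icc (0 : ℝ) 1, γ s ∈ closedBall x (1 / R.N 1)) ∧
      (∀ s ∈ Icc (0 : ℝ) 1, ‖deriv γ s‖ ≤ 8 * Real.pi / R.N 1) ∧
      R.N 1 ^ (R.β - 2) + η ≤ circulation (v (Host.τfirstAt R)) γ) :
    NoSwirlRungGAt R 1 := by
  obtain ⟨U, ρ', hLZ, haxU, hswU, u, p, hu, hu1, huE, hη2, hucap, husp, hust, huco⟩ :=
    exists_sterile_levelZeroDataAt_freeRun_of_sterile_amplifier hR hax hsw hW hdivW hWsupp hWlt hρ hv hv1 hvE hη hcap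
      hspeed hstrain hcore
  exact palasekTowerBreakdown_noSwirlRungGAt_one_of_sterile_freeRun hLZ haxU hswU hR hu hu1 huE hη2 hucap husp hust huco

/-- **STUB D2 `SterileMechanismDoorT` OF THE LINE «doormirror», VERBATIM** (the mechanism door walked STERILE at the tuned
rates): for every axisymmetric swirl-free `W` meeting the door box at `tuned` — same binders as
`StrainDoor.MechanismDoorAt TowerRates.tuned` plus `IsAxisymmetric W`, `HasNoSwirl W` — `NoSwirlRungAtOneT`. Proof = D2b
(ecbridge-3 g12, `palasekTowerBreakdown_sterileMechanismDoorT_of_sterileSmallCarrierT`, p562247) applied to D2a above; the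
`R`-generic statement is `palasekTowerBreakdown_noSwirlRungGAt_one_of_sterile_amplifier` (this seat's own door).
[cite: Palasek2026ElementaryModel, §4] [cite: Kato1984, Thm. 2–4] -/
theorem palasekTowerBreakdown_sterileMechanismDoorT :
    ∀ ⦃W : EuclideanSpace ℝ (Fin 3) → EuclideanSpace ℝ (Fin 3)⦄ ⦃ρ : ℝ⦄,
    IsAxisymmetric W → HasNoSwirl W →
    ContDiff ℝ ∞ W → VectorCalculus.IsDivFree W → tsupport W ⊆ closedBall 0 ρ →
    (∀ x, ‖W x‖ < TowerRates.tuned.Y 0) → 0 ≤ ρ →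
    ∀ ⦃v : ℝ → EuclideanSpace ℝ (Fin 3) → EuclideanSpace ℝ (Fin 3)⦄ ⦃q : ℝ → EuclideanSpace ℝ (Fin 3) → ℝ⦄,
      IsClassicalNSSolutionOn (Icc 1 (Host.τfirstAt TowerRates.tuned)) 1 0 v q → v 1 = W →
      (∃ C : ℝ≥0∞, C < ⊤ ∧ ∀ t ∈ Icc (1 : ℝ) (Host.τfirstAt TowerRates.tuned), ∫⁻ x, ‖v t x‖ₑ ^ 2 ≤ C) →
      ∀ ⦃η : ℝ⦄, 0 < η →
        (∀ t ∈ Icc (1 : ℝ) (Host.τfirstAt TowerRates.tuned), ∀ x, ‖v t x‖ ≤ 5 / 3 * TowerRates.tuned.Y 1 - η) →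
        (∃ x, ‖x‖ ≤ ρ ∧ TowerRates.tuned.Y 1 + η ≤ ‖v (Host.τfirstAt TowerRates.tuned) x‖) →
        (∃ x, ‖x‖ ≤ ρ ∧ TowerRates.tuned.A 1 + η ≤ ‖fderiv ℝ (v (Host.τfirstAt TowerRates.tuned)) x‖) →
        (∃ (x : EuclideanSpace ℝ (Fin 3)) (γ : ℝ → EuclideanSpace ℝ (Fin 3)),
          ‖x‖ ≤ ρ ∧ ContDiff ℝ 1 γ ∧ γ 0 = γ 1 ∧
          (∀ s ∈ Icc (0 : ℝ) 1, γ s ∈ closedBall x (1 / TowerRates.tuned.N 1)) ∧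
          (∀ s ∈ Icc (0 : ℝ) 1, ‖deriv γ s‖ ≤ 8 * Real.pi / TowerRates.tuned.N 1) ∧
          TowerRates.tuned.N 1 ^ (TowerRates.tuned.β - 2) + η ≤ circulation (v (Host.τfirstAt TowerRates.tuned)) γ) →
        NoSwirlRungAtOneT :=
  palasekTowerBreakdown_sterileMechanismDoorT_of_sterileSmallCarrierT palasekTowerBreakdown_sterileSmallCarrierT

/-- **… HENCE: ONE FREE RUN OF A STERILE AMPLIFIER MEETING THE PLAIN DOOR BOX AT `tuned` GIVES `EpisodeBaseT` AND REFUTES THE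
HEREDITY PAIR** (K201 `not_noSwirlRungAtOneT_of_heredity_pair`; the door of record re-walked sterile — no level-`0` face, no
anchor, no far field asked of `W`). [cite: LemarieRieusset2016, Thm 10.4 (p. 285)] [cite: Palasek2026ElementaryModel, §4] -/
theorem palasekTowerBreakdown_episodeBaseT_and_not_heredity_pair_of_sterile_amplifier
    {W : EuclideanSpace ℝ (Fin 3) → EuclideanSpace ℝ (Fin 3)} {ρ : ℝ} (hax : IsAxisymmetric W) (hsw : HasNoSwirl W)
    (hW : ContDiff ℝ ∞ W) (hdivW : VectorCalculus.IsDivFree W) (hWsupp : tsupport W ⊆ closedBall 0 ρ)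
    (hWlt : ∀ x, ‖W x‖ < TowerRates.tuned.Y 0) (hρ : 0 ≤ ρ)
    {v : ℝ → EuclideanSpace ℝ (Fin 3) → EuclideanSpace ℝ (Fin 3)} {q : ℝ → EuclideanSpace ℝ (Fin 3) → ℝ}
    (hv : IsClassicalNSSolutionOn (Icc 1 (Host.τfirstAt TowerRates.tuned)) 1 0 v q) (hv1 : v 1 = W)
    (hvE : ∃ C : ℝ≥0∞, C < ⊤ ∧ ∀ t ∈ Icc (1 : ℝ) (Host.τfirstAt TowerRates.tuned), ∫⁻ x, ‖v t x‖ₑ ^ 2 ≤ C)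
    {η : ℝ} (hη : 0 < η)
    (hcap : ∀ t ∈ Icc (1 : ℝ) (Host.τfirstAt TowerRates.tuned), ∀ x, ‖v t x‖ ≤ 5 / 3 * TowerRates.tuned.Y 1 - η)
    (hspeed : ∃ x, ‖x‖ ≤ ρ ∧ TowerRates.tuned.Y 1 + η ≤ ‖v (Host.τfirstAt TowerRates.tuned) x‖)
    (hstrain : ∃ x, ‖x‖ ≤ ρ ∧ TowerRates.tuned.A 1 + η ≤ ‖fderiv ℝ (v (Host.τfirstAt TowerRates.tuned)) x‖)
    (hcore : ∃ (x : EuclideanSpace ℝ (Fin 3)) (γ : ℝ → EuclideanSpace ℝ (Fin 3)),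
      ‖x‖ ≤ ρ ∧ ContDiff ℝ 1 γ ∧ γ 0 = γ 1 ∧
      (∀ s ∈ Icc (0 : ℝ) 1, γ s ∈ closedBall x (1 / TowerRates.tuned.N 1)) ∧
      (∀ s ∈ Icc (0 : ℝ) 1, ‖deriv γ s‖ ≤ 8 * Real.pi / TowerRates.tuned.N 1) ∧
      TowerRates.tuned.N 1 ^ (TowerRates.tuned.β - 2) + η ≤ circulation (v (Host.τfirstAt TowerRates.tuned)) γ) :
    PalasekTowerBreakdown.EpisodeBaseT ∧
      ¬ (PalasekTowerBreakdown.HeredityAtOneT ∧ PalasekTowerBreakdown.HeredityFromTwoT) := by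
  have hW' : NoSwirlRungAtOneT :=
    palasekTowerBreakdown_sterileMechanismDoorT hax hsw hW hdivW hWsupp hWlt hρ hv hv1 hvE hη hcap hspeed hstrain hcore
  refine ⟨?_, fun hp => not_noSwirlRungAtOneT_of_heredity_pair hp.1 hp.2 hW'⟩
  obtain ⟨S, hP, hRg, hQ, -, hs⟩ := hW'
  exact ⟨S, hP, hRg, hQ, hs⟩

/-! ## The sterile stratum is INHABITED at level `0` (unconditional) -/

/-- **UNCONDITIONAL: `NoSwirlRungGAt R 0` at every register-admissible `R`** — the germ schedule of the STERILE tame carrier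
(`exists_sterile_levelZeroDataAt_small`: zero datum, faded line-germ residual as force, both axisymmetric swirl free by
`LevelZeroDataAt.schedule_axisym_noSwirl`) is a pinned rigid quiet swirl-free design carrying a registered LEVEL-`0` stage
(`LevelZeroDataAt.stage`). So the refuters' class exclusions `isEmpty_noSwirl_stage_of_heredityGAt` (levels `≥ 1` under the
heredity pair) are SHARP in the level: the swirl-free stratum of K201 is non-empty at the base. [cite: Palasek2026ElementaryModel, §3.3] -/
theorem palasekTowerBreakdown_noSwirlRungGAt_zero_of_boxNumerics {R : TowerRates} {c₃ r : ℝ} (hR : R.BoxNumerics c₃ r) :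
    NoSwirlRungGAt R 0 := by
  obtain ⟨U, hLZ, hax, hsw, -⟩ := exists_sterile_levelZeroDataAt_small R 1 one_pos
  exact ⟨hLZ.schedule hR 1 one_pos le_rfl, hLZ.schedule_pins hR one_pos le_rfl, hLZ.schedule_rigid hR one_pos le_rfl,
    hLZ.schedule_quiet hR one_pos le_rfl, hLZ.schedule_axisym_noSwirl hR one_pos le_rfl hax hsw, hLZ.stage hR one_pos le_rfl⟩

/-- **UNCONDITIONAL: `NoSwirlRungGAt TowerRates.tuned 0`** — a sterile pinned rigid quiet TUNED design with a registered
level-`0` stage exists (the sterile host preparation of the route). [cite: Palasek2026ElementaryModel, §3.3] -/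
theorem palasekTowerBreakdown_noSwirlRungGAt_tuned_zero : NoSwirlRungGAt TowerRates.tuned 0 :=
  palasekTowerBreakdown_noSwirlRungGAt_zero_of_boxNumerics TowerRates.tuned_boxNumerics

/-- **UNCONDITIONAL: heredity on the tuned register breaks at SOME DEFINITE LEVEL `k ≥ 0` inside the swirl-free stratum** —
the sterile level-`0` rung climbs to its LAST level `k` (`NoSwirlRungGAt.exists_not_heredityAtGAt`: the forced swirl-free design is
globally regular, `forcedNoSwirlGlobal_holds`), where `HeredityAtGAt tuned k` fails. WHICH `k` is not decided here; `k = 0` is the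
expected one (the germ design of the tame carrier is not meant to reach level `1`), so this is a census statement, not a refutation of
20304/20305. [cite: LemarieRieusset2016, Thm 10.4 (p. 285)] -/
theorem palasekTowerBreakdown_exists_noSwirlRung_not_heredityAtGAt_tuned :
    ∃ k : ℕ, NoSwirlRungGAt TowerRates.tuned k ∧ ¬ HeredityAtGAt TowerRates.tuned k := by
  obtain ⟨k, -, hk, hH⟩ := palasekTowerBreakdown_noSwirlRungGAt_tuned_zero.exists_not_heredityAtGAt
  exact ⟨k, hk, hH⟩

/-- **The unconditional trichotomy by the route's names**: `¬ HeredityAtGAt tuned 0 ∨ ¬ HeredityAtOneT ∨ ¬ HeredityFromTwoT` (the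
first disjunct is the expected one; nothing about 20304/20305 is claimed). [cite: LemarieRieusset2016, Thm 10.4 (p. 285)] -/
theorem palasekTowerBreakdown_not_heredityAtGAt_zero_or_not_pair :
    ¬ HeredityAtGAt TowerRates.tuned 0 ∨
      (¬ PalasekTowerBreakdown.HeredityAtOneT ∨ ¬ PalasekTowerBreakdown.HeredityFromTwoT) := by
  obtain ⟨k, hk, hH⟩ := palasekTowerBreakdown_exists_noSwirlRung_not_heredityAtGAt_tuned
  rcases Nat.eq_zero_or_pos k with h0 | hpos
  · subst h0
    exact Or.inl hH
  · rcases Nat.lt_or_ge k 2 with hlt | hge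
    · have hk1 : k = 1 := by omega
      subst hk1
      exact Or.inr (HeredityAtOneT_false_or_HeredityFromTwoT_false_of_noSwirlRungAtOneT hk)
    · exact Or.inr (Or.inr (HeredityFromTwoT_false_of_noSwirlRungGAt hge hk))

/-! ## In kit units (the dictionary of `PalasekTowerSterileMechanismDoorAtScaled`) -/

/-- **The sterile door at `R` as a `StrainDoor.SterileDoorAt` instance** (conclusion `NoSwirlRungGAt R 1`).
[cite: Palasek2026ElementaryModel, §4] -/
theorem palasekTowerBreakdown_sterileDoorAt_of_boxNumerics {R : TowerRates} {c₃ r : ℝ} (hR : R.BoxNumerics c₃ r) :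
    StrainDoor.SterileDoorAt R (NoSwirlRungGAt R 1) :=
  fun _ _ hax hsw hW hdiv hsupp hlt hρ _ _ hv hv1 hE _ hη hcap hspeed hstrain hcore =>
    palasekTowerBreakdown_noSwirlRungGAt_one_of_sterile_amplifier hR hax hsw hW hdiv hsupp hlt hρ hv hv1 hE hη hcap hspeed
      hstrain hcore

/-- **The sterile door at `tuned` as a `StrainDoor.SterileDoorAt` instance deciding the fork**: conclusion
`EpisodeBaseT ∧ ¬ (HeredityAtOneT ∧ HeredityFromTwoT)`. [cite: Palasek2026ElementaryModel, §4] [cite: LemarieRieusset2016, Thm 10.4 (p. 285)] -/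
theorem palasekTowerBreakdown_sterileDoorAt_tuned :
    StrainDoor.SterileDoorAt TowerRates.tuned (PalasekTowerBreakdown.EpisodeBaseT ∧
      ¬ (PalasekTowerBreakdown.HeredityAtOneT ∧ PalasekTowerBreakdown.HeredityFromTwoT)) :=
  fun _ _ hax hsw hW hdiv hsupp hlt hρ _ _ hv hv1 hE _ hη hcap hspeed hstrain hcore =>
    palasekTowerBreakdown_episodeBaseT_and_not_heredity_pair_of_sterile_amplifier hax hsw hW hdiv hsupp hlt hρ hv hv1 hE hη
      hcap hspeed hstrain hcore

/-- **THE STERILE DOOR IN KIT UNITS AT EVERY REGISTER-ADMISSIBLE `R`**: a classical FREE run with viscosity `ν' > 0` on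
`[t_a, t_a + κ²ν'·wfirstAt R]` whose release slice `v t_a` is AXISYMMETRIC SWIRL FREE, supported in `B̄(x₀, ρ)` with `x₀` ON THE
AXIS, `κ‖v t_a‖ < Y₀(R)`, finite energy, cap `κ‖v‖ ≤ (5/3)Y₁(R) − η`, and at `t_a + T` in `B̄(x₀, ρ)`: `κ‖v‖ ≥ Y₁(R) + η`,
`κ²ν'‖Dv‖ ≥ A₁(R) + η`, a loop in a ball of radius `κν'/N₁(R)` of speed `≤ 8πκν'/N₁(R)` and circulation `≥ ν'(N₁(R)^{β−2} + η)`
⟹ `NoSwirlRungGAt R 1`. [cite: Leray1934, §20] [cite: Palasek2026ElementaryModel, §4] -/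
theorem palasekTowerBreakdown_noSwirlRungGAt_one_of_scaled_sterile_amplifier {R : TowerRates} {c₃ r : ℝ}
    (hR : R.BoxNumerics c₃ r) {ν' κ : ℝ} (hν' : 0 < ν') (hκ : 0 < κ) (t_a : ℝ) {x₀ : EuclideanSpace ℝ (Fin 3)}
    (hx₀ : x₀ 0 = 0 ∧ x₀ 1 = 0) {T : ℝ} (hT : T = κ ^ 2 * ν' * Host.wfirstAt R)
    {v : ℝ → EuclideanSpace ℝ (Fin 3) → EuclideanSpace ℝ (Fin 3)} {q : ℝ → EuclideanSpace ℝ (Fin 3) → ℝ}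
    (hv : IsClassicalNSSolutionOn (Icc t_a (t_a + T)) ν' 0 v q)
    (hax : IsAxisymmetric (v t_a)) (hsw : HasNoSwirl (v t_a))
    {ρ : ℝ} (hρ : 0 ≤ ρ) (hsupp : tsupport (v t_a) ⊆ closedBall x₀ ρ)
    (hlt : ∀ x, κ * ‖v t_a x‖ < R.Y 0)
    (hE : ∃ C : ℝ≥0∞, C < ⊤ ∧ ∀ t ∈ Icc t_a (t_a + T), ∫⁻ x, ‖v t x‖ₑ ^ 2 ≤ C)
    {η : ℝ} (hη : 0 < η)
    (hcap : ∀ t ∈ Icc t_a (t_a + T), ∀ x, κ * ‖v t x‖ ≤ 5 / 3 * R.Y 1 - η)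
    (hspeed : ∃ x, ‖x - x₀‖ ≤ ρ ∧ R.Y 1 + η ≤ κ * ‖v (t_a + T) x‖)
    (hstrain : ∃ x, ‖x - x₀‖ ≤ ρ ∧ R.A 1 + η ≤ κ ^ 2 * ν' * ‖fderiv ℝ (v (t_a + T)) x‖)
    (hcore : ∃ (x : EuclideanSpace ℝ (Fin 3)) (c : ℝ → EuclideanSpace ℝ (Fin 3)),
      ‖x - x₀‖ ≤ ρ ∧ ContDiff ℝ 1 c ∧ c 0 = c 1 ∧
      (∀ s ∈ Icc (0 : ℝ) 1, c s ∈ closedBall x (κ * ν' / R.N 1)) ∧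
      (∀ s ∈ Icc (0 : ℝ) 1, ‖deriv c s‖ ≤ 8 * Real.pi * (κ * ν') / R.N 1) ∧
      ν' * (R.N 1 ^ (R.β - 2) + η) ≤ circulation (v (t_a + T)) c) :
    NoSwirlRungGAt R 1 :=
  (palasekTowerBreakdown_sterileDoorAt_of_boxNumerics hR).of_scaledFreeRun hν' hκ t_a hx₀ hT hv hax hsw hρ hsupp hlt hE hη
    hcap hspeed hstrain hcore

/-- **THE STERILE DOOR IN KIT UNITS AT `tuned` DECIDES THE FORK**: the same kit run at the tuned rates gives
`EpisodeBaseT ∧ ¬ (HeredityAtOneT ∧ HeredityFromTwoT)` — what a sterile member of the STERILE-DOOR test meeting the plain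
READING-2 box (destination (A)) would mean in the kernel. [cite: Leray1934, §20] [cite: LemarieRieusset2016, Thm 10.4 (p. 285)] -/
theorem palasekTowerBreakdown_episodeBaseT_and_not_heredity_pair_of_scaled_sterile_amplifier
    {ν' κ : ℝ} (hν' : 0 < ν') (hκ : 0 < κ) (t_a : ℝ) {x₀ : EuclideanSpace ℝ (Fin 3)}
    (hx₀ : x₀ 0 = 0 ∧ x₀ 1 = 0) {T : ℝ} (hT : T = κ ^ 2 * ν' * Host.wfirstAt TowerRates.tuned)
    {v : ℝ → EuclideanSpace ℝ (Fin 3) → EuclideanSpace ℝ (Fin 3)} {q : ℝ → EuclideanSpace ℝ (Fin 3) → ℝ}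
    (hv : IsClassicalNSSolutionOn (Icc t_a (t_a + T)) ν' 0 v q)
    (hax : IsAxisymmetric (v t_a)) (hsw : HasNoSwirl (v t_a))
    {ρ : ℝ} (hρ : 0 ≤ ρ) (hsupp : tsupport (v t_a) ⊆ closedBall x₀ ρ)
    (hlt : ∀ x, κ * ‖v t_a x‖ < TowerRates.tuned.Y 0)
    (hE : ∃ C : ℝ≥0∞, C < ⊤ ∧ ∀ t ∈ Icc t_a (t_a + T), ∫⁻ x, ‖v t x‖ₑ ^ 2 ≤ C)
    {η : ℝ} (hη : 0 < η)
    (hcap : ∀ t ∈ Icc t_a (t_a + T), ∀ x, κ * ‖v t x‖ ≤ 5 / 3 * TowerRates.tuned.Y 1 - η)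
    (hspeed : ∃ x, ‖x - x₀‖ ≤ ρ ∧ TowerRates.tuned.Y 1 + η ≤ κ * ‖v (t_a + T) x‖)
    (hstrain : ∃ x, ‖x - x₀‖ ≤ ρ ∧ TowerRates.tuned.A 1 + η ≤ κ ^ 2 * ν' * ‖fderiv ℝ (v (t_a + T)) x‖)
    (hcore : ∃ (x : EuclideanSpace ℝ (Fin 3)) (c : ℝ → EuclideanSpace ℝ (Fin 3)),
      ‖x - x₀‖ ≤ ρ ∧ ContDiff ℝ 1 c ∧ c 0 = c 1 ∧
      (∀ s ∈ Icc (0 : ℝ) 1, c s ∈ closedBall x (κ * ν' / TowerRates.tuned.N 1)) ∧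
      (∀ s ∈ Icc (0 : ℝ) 1, ‖deriv c s‖ ≤ 8 * Real.pi * (κ * ν') / TowerRates.tuned.N 1) ∧
      ν' * (TowerRates.tuned.N 1 ^ (TowerRates.tuned.β - 2) + η) ≤ circulation (v (t_a + T)) c) :
    PalasekTowerBreakdown.EpisodeBaseT ∧
      ¬ (PalasekTowerBreakdown.HeredityAtOneT ∧ PalasekTowerBreakdown.HeredityFromTwoT) :=
  palasekTowerBreakdown_sterileDoorAt_tuned.of_scaledFreeRun hν' hκ t_a hx₀ hT hv hax hsw hρ hsupp hlt hE hη hcap hspeed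
    hstrain hcore

end Summit.NavierStokesRegularity.NavierStokesRegularity.Theorems

end
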